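import Summits.QuantumFields.BalabanUV.T4Continuum.Support.NE9Lemma1KernelSpecies
import Summits.QuantumFields.BalabanUV.T4Continuum.Support.NE9CPieceCouplingModulus
import Summits.QuantumFields.BalabanUV.T4Continuum.Support.NE9Lemma1RemainderSpeciesAdditive

/-!
# NE9KernelSpeciesCoupling — leaf A3 for the KERNEL species ([I] §4 point-localized terms): the per-piece COUPLING RESPONSE of
# `KerData.toC` on the analytic class from ONE displayed coupling-Lipschitz TYPE binder on the bilocal summand + (G)/(S) of
# `KerData.Admissible`, and the END's `hTcup` for the species' channel by `channelCouplingModulus_cpiece` at the OUTPUT rate κ − w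
# (cell `pub-balaban`, T4-DAG §2 node U3 / §6 NE9; swarm unit b2b-balaban-t4-ne9-formalise-leaf-09, generation 6; own-initiative
# micro-item «A3-KER», journal CLAIM l.10578 — the species-(b) twin of A3-REM p213083 / A3-CUR (w20); the producer of (w25)-M's
# `hTcupb` (p214472) named open in l.10417 / l.10534; a parallel draft by leaf-06-g7 (l.10663) reached the same letters)

HONEST FRAMING (T4-DAG PAGE 1).  Rung (B)+1 of the FINITE-VOLUME T⁴ programme — NOT infinite volume, NOT a mass gap, NOT the
Clay problem.  NE9 (`T4OutputRate.NE9` ∧ `FadingMemory`) is a cell NEW ESTIMATE, NOT PRINTED, NOT discharged here; spine 0/9;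
0/18 skeleton leaves instantiated on Bałaban's objects (O-NE9-1).  HONEST DEPENDENCY (cell line, verbatim): continuum YM on T⁴
⇐ BetaPertH ∧ nine spine estimates (0/9 proved); BetaPertH ⇐ (D1) ∧ (D4) ∧ CAP+tail; G-an2-4 gates asym, D1 and NE2/3/4.
`FlowStep.BetaPertH`, (B), (B^μ) do not occur.  [I] = [Balaban1987RG1] (CMP **109**), [II] = [Balaban1988RG2Cluster] (CMP
**116**) are quoted for TYPES only (ABSOLUTE RULE: nothing printed in the audited series is asserted).

WHERE THIS SITS.  The NE9 END consumes, per species channel, leaf A3's coupling modulus `hTcup` (the SAME old terms at two values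
of the LAST coupling); for the piece form it is produced by `NE9CPieceCouplingModulus.channelCouplingModulus_cpiece` (p212551)
from ONE per-piece coupling-response bound `hresp`.  Species (a) has producers (A3-REM, A3-CUR); the owner g25's KERNEL species
`NE9Lemma1KernelSpecies.KerData` (p214555; [I] (4.20)–(4.30), bounded by the (4.22) mechanism) had none, so the (b) side of the
assembled channel of crew row (w25) (`NE9ChannelSumMargProj.tcup_add`) was unfed.  In print the kernels read the last coupling
through `B′ = g_kCB − hD̃(g_kCB)` ([I] (3.2) p. 270) inside the field factors of the p. 286 display; the actions are *"C^∞-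
function[s] of g_{j−1}"* ([I] p. 263) — no constant printed, as for species (a)'s direction maps (A3-REM's (d2)).  THIS FILE:
* §1 `contourFn_sub`: the (1.23) contour functional `G ↦ (2πi)⁻¹∮_{|t|=r} t⁻²·cauchyOp e^{κ₁} l (G t) s σ` is SUBTRACTIVE on jointly
  continuous integrand families (core of `NE9RemainderPieceAdditive.remPiece_sub`; = (w23)'s announced `contourOp_sub`).
* §2 **`norm_sum_sum_le_of_pointBound`** — the (4.22) arithmetic, GENERIC (pointwise (K)-shape bound with constant Λ + (G) + (S)
  ⟹ `‖Σ_pΣ_q f‖ ≤ Λ·e^{Wd}·c₀·c₁`; the owner's `norm_dsum_le` re-derived as an `example`); **`norm_dsum_sub_dsum_le`** (the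
  coupling difference of the double point sum); `continuous_dsum` under (C).
* §3 **`cpieceResponse_ker`** — conclusion LITERALLY `channelCouplingModulus_cpiece`'s `hresp` at `P := K.toC`, rate **κ − w**,
  `Kp := K.Kp cK w₀ c₀ c₁` (the S5 constant, so S5 and A3 share the END's weight), `qc := λ·N̄`.  Chain: `reIm` difference; §1;
  `B13Sect1Arith.bound_124` with §2's bound (M := 2e^{−κd(X)}N_j on both copies of X); `e^{−κd}e^{wd} = e^{−(κ−w)d}`; `bound_125`.
* §4 **`channelCouplingModulus_ker`** — leaf A3 (`hTcup`) for `T := cpieceChannel K.toC`: p212551 §1 APPLIED BY NAME at rate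
  κ − w with `LevelCountsG K.toC.frame (κ − w) …` (as in `channelSizeAtStepNN_ker`); `qT := λ·N̄·c_Q·(1 − ω)⁻¹`.
DISPLAYED (TYPE / O1-side, asserted nowhere): `KerData.Admissible`; **(K-Lip)** `hkerL` — the coupling-Lipschitz twin of (K) with
RELATIVE modulus λ ≥ 0 (constant `cK·λ`), for F analytic on the source's ball bounded by M, on the contours (PROOF-INTERIOR of
[I] §4 ⊕ (3.2)); **(C)** `hkerC` — joint continuity of the summand in (t, s′, σ′) for analytic F (leaf-01-g6's (w23) binder
VERBATIM); the level counts at κ − w; `TermSize`; analyticity of the window's terms.  (G)/(S) are reduced for the lattice model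
elsewhere (`NE9KernelGeometry` p214491, `NE9LatticeExpSums` p214386).  DISGUISE TEST: one input family, two values of the LAST
coupling — leaf A3, not NE9; 0 def; constants symbolic.

References (TYPES only): [Balaban1987RG1] T. Bałaban, CMP **109** (1987) 249–301 — (1.18) p. 263, (3.2) p. 270, (4.17)–(4.22)
pp. 285–286, p. 288; [Balaban1988RG2Cluster] T. Bałaban, CMP **116** (1988) 1–22 — (1.21)–(1.29) pp. 7–8, (1.33)–(1.36) p. 9.
Summits-side NEW work (LEAN PLACEMENT RULE); imports `NE9Lemma1KernelSpecies` (p214555), `NE9CPieceCouplingModulus` (p212551),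
`NE9Lemma1RemainderSpeciesAdditive` (p213082; `reIm_sub`, transitively `NE9RemainderPieceAdditive` p212653's `cauchyOp`
suppliers) BY NAME; modifies nothing; 0 sorry.  Value = one END binder's species-(b) producer at form
level, NOT summit progress.
-/


noncomputable section

namespace Summit.QuantumFields.BalabanUV.T4Continuum.NE9KernelSpeciesCoupling

open scoped BigOperators
open Metric Set Complex
open Literature.MathematicalPhysics.QuantumFieldTheory.Balaban1983to89
open Literature.MathematicalPhysics.QuantumFieldTheory.Balaban1983to89.T4OutputRate
open Literature.MathematicalPhysics.QuantumFieldTheory.Balaban1983to89.T4HistoryLipschitzRecursion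
open Literature.MathematicalPhysics.QuantumFieldTheory.Balaban1983to89.T4HistoryLipschitzSegment
open Literature.MathematicalPhysics.QuantumFieldTheory.Balaban1983to89.B13Sect1Arith (cauchyOp)
open Summit.QuantumFields.BalabanUV.T4Continuum.NE9Lemma1Counting
open Summit.QuantumFields.BalabanUV.T4Continuum.NE9Lemma1Gain
open Summit.QuantumFields.BalabanUV.T4Continuum.NE9Lemma1PieceClass
open Summit.QuantumFields.BalabanUV.T4Continuum.NE9Lemma1RemainderSpecies
open Summit.QuantumFields.BalabanUV.T4Continuum.NE9Lemma1KernelSpecies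
open Summit.QuantumFields.BalabanUV.T4Continuum.NE9CPieceCouplingModulus
open Summit.QuantumFields.BalabanUV.T4Continuum.NE9RemainderPieceAdditive (continuous_cauchyOp cauchyOp_sub)
open Summit.QuantumFields.BalabanUV.T4Continuum.NE9Lemma1RemainderSpeciesAdditive (reIm_sub)
open Summit.QuantumFields.BalabanUV.T4Continuum.NE9ComplexEncoding (doubleCarriers)

/-! ## §1 The (1.23) contour functional is subtractive on jointly continuous integrand families -/

section Contour

variable {ι : Type*} [DecidableEq ι] {F : Type*} [NormedAddCommGroup F] [NormedSpace ℂ F]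

/-- **SUBTRACTIVITY OF THE (1.23) CONTOUR FUNCTIONAL** `G ↦ (2πi)⁻¹∮_{|t|=r} t⁻² • cauchyOp ρ l (G t) s σ` on integrand families
JOINTLY CONTINUOUS in `(t, s′, σ′)` (`ρ > 1`, `r > 0`): `cauchyOp_sub` under joint continuity, continuity in `t`
(`continuous_cauchyOp`), circle-integrability against `t⁻²`, `circleIntegral.integral_sub` (the core of `remPiece_sub`). [folklore] -/
theorem contourFn_sub {ρ r : ℝ} (hρ : 1 < ρ) (hr : 0 < r) (l : List ι) {G₁ G₂ : ℂ → (ι → ℝ) → (ι → ℂ) → F}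
    (hG₁ : Continuous fun p : ℂ × (ι → ℝ) × (ι → ℂ) => G₁ p.1 p.2.1 p.2.2)
    (hG₂ : Continuous fun p : ℂ × (ι → ℝ) × (ι → ℂ) => G₂ p.1 p.2.1 p.2.2) (s : ι → ℝ) (σ : ι → ℂ) :
    (2 * Real.pi * I : ℂ)⁻¹ • (∮ t in C(0, r), (t ^ 2)⁻¹ • cauchyOp ρ l (fun s' σ' => G₁ t s' σ' - G₂ t s' σ') s σ) =
      (2 * Real.pi * I : ℂ)⁻¹ • (∮ t in C(0, r), (t ^ 2)⁻¹ • cauchyOp ρ l (G₁ t) s σ) -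
        (2 * Real.pi * I : ℂ)⁻¹ • (∮ t in C(0, r), (t ^ 2)⁻¹ • cauchyOp ρ l (G₂ t) s σ) := by
  have hcont : ∀ {G : ℂ → (ι → ℝ) → (ι → ℂ) → F}, (Continuous fun p : ℂ × (ι → ℝ) × (ι → ℂ) => G p.1 p.2.1 p.2.2) →
      Continuous fun t : ℂ => cauchyOp ρ l (G t) s σ := by
    intro G hG
    have e : Continuous fun t : ℂ => (t, (s, σ)) :=
      continuous_id.prodMk (continuous_const : Continuous fun _ : ℂ => (s, σ))
    exact (continuous_cauchyOp (X := ℂ) hρ l (h := G) hG).comp e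
  have hci : ∀ {G : ℂ → (ι → ℝ) → (ι → ℂ) → F}, (Continuous fun p : ℂ × (ι → ℝ) × (ι → ℂ) => G p.1 p.2.1 p.2.2) →
      CircleIntegrable (fun t => (t ^ 2)⁻¹ • cauchyOp ρ l (G t) s σ) 0 r := by
    intro G hG
    refine ContinuousOn.circleIntegrable hr.le (ContinuousOn.smul ?_ (hcont hG).continuousOn)
    refine ContinuousOn.inv₀ (by fun_prop) fun t ht => pow_ne_zero _ ?_
    intro h0
    have htn : ‖t‖ = r := by simpa using ht
    rw [h0, norm_zero] at htn
    exact hr.ne' htn.symm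
  have hpt : ∀ t : ℂ, cauchyOp ρ l (fun s' σ' => G₁ t s' σ' - G₂ t s' σ') s σ =
      cauchyOp ρ l (G₁ t) s σ - cauchyOp ρ l (G₂ t) s σ := by
    intro t
    have e : Continuous fun q : (ι → ℝ) × (ι → ℂ) => (t, q) :=
      (continuous_const : Continuous fun _ : (ι → ℝ) × (ι → ℂ) => t).prodMk continuous_id
    exact cauchyOp_sub hρ l (h₁ := G₁ t) (h₂ := G₂ t) (hG₁.comp e) (hG₂.comp e) s σ
  simp_rw [hpt, smul_sub]
  rw [circleIntegral.integral_sub (hci hG₁) (hci hG₂), smul_sub]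

end Contour

/-! ## §2 The (4.22) arithmetic, generic, and the coupling difference of the double point sum -/

section DoubleSum

/-- **THE (4.22) ARITHMETIC, GENERIC** ([I] p. 286 *"Summing over x, x₃ we get finally the following estimate"*, the chain
typed): a bilocal summand bounded on the point family by `Λ·(ρd p q)^m·exp(−δ₀·(dX p + dX q))`, the geometry (G)
`δ₁ρd(p₀,p) + δ₁ρd(p,q) ≤ δ₀(dX p + dX q) + Wd` and the lattice sums (S) `Σ_p e^{−δ₁ρd(p₀,p)} ≤ c₀`, `Σ_q (ρd p q)^m e^{−δ₁ρd(p,q)}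
≤ c₁` give `‖Σ_p Σ_q f p q‖ ≤ Λ·e^{Wd}·c₀·c₁`. [cite: Balaban1987RG1, (4.22) p.286] -/
theorem norm_sum_sum_le_of_pointBound {Pt F : Type*} [SeminormedAddCommGroup F] (pts : Finset Pt) (f : Pt → Pt → F)
    (ρd : Pt → Pt → ℝ) (dX : Pt → ℝ) (p₀ : Pt) {Λ δ₀ δ₁ Wd c0 c1 : ℝ} {m : ℕ} (hΛ : 0 ≤ Λ) (hc1 : 0 ≤ c1)
    (hρd : ∀ p q, 0 ≤ ρd p q)
    (hf : ∀ p ∈ pts, ∀ q ∈ pts, ‖f p q‖ ≤ Λ * ρd p q ^ m * Real.exp (-(δ₀ * (dX p + dX q))))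
    (hgeo : ∀ p ∈ pts, ∀ q ∈ pts, δ₁ * ρd p₀ p + δ₁ * ρd p q ≤ δ₀ * (dX p + dX q) + Wd)
    (hsum0 : ∑ p ∈ pts, Real.exp (-(δ₁ * ρd p₀ p)) ≤ c0)
    (hsum1 : ∀ p ∈ pts, ∑ q ∈ pts, ρd p q ^ m * Real.exp (-(δ₁ * ρd p q)) ≤ c1) :
    ‖∑ p ∈ pts, ∑ q ∈ pts, f p q‖ ≤ Λ * Real.exp Wd * c0 * c1 := by
  set A : ℝ := Λ * Real.exp Wd with hA
  have hA0 : 0 ≤ A := mul_nonneg hΛ (Real.exp_pos _).le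
  -- pointwise: summand ≤ A · e^{−δ₁ρ(p₀,p)} · (ρ^m e^{−δ₁ ρ(p,q)})   (bound, then (G))
  have hpt : ∀ p ∈ pts, ∀ q ∈ pts, ‖f p q‖ ≤
      A * (Real.exp (-(δ₁ * ρd p₀ p)) * (ρd p q ^ m * Real.exp (-(δ₁ * ρd p q)))) := by
    intro p hp q hq
    have h1 := hf p hp q hq
    have hg := hgeo p hp q hq
    have hexp : Real.exp (-(δ₀ * (dX p + dX q))) ≤
        Real.exp Wd * (Real.exp (-(δ₁ * ρd p₀ p)) * Real.exp (-(δ₁ * ρd p q))) := by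
      rw [← Real.exp_add, ← Real.exp_add]
      exact Real.exp_le_exp.mpr (by linarith)
    have hc : 0 ≤ Λ * ρd p q ^ m := mul_nonneg hΛ (pow_nonneg (hρd p q) _)
    calc ‖f p q‖ ≤ Λ * ρd p q ^ m * Real.exp (-(δ₀ * (dX p + dX q))) := h1
      _ ≤ Λ * ρd p q ^ m * (Real.exp Wd * (Real.exp (-(δ₁ * ρd p₀ p)) * Real.exp (-(δ₁ * ρd p q)))) :=
          mul_le_mul_of_nonneg_left hexp hc
      _ = A * (Real.exp (-(δ₁ * ρd p₀ p)) * (ρd p q ^ m * Real.exp (-(δ₁ * ρd p q)))) := by rw [hA]; ring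
  -- inner sum over q ((S), second clause)
  have hinner : ∀ p ∈ pts, ∑ q ∈ pts, ‖f p q‖ ≤ A * c1 * Real.exp (-(δ₁ * ρd p₀ p)) := by
    intro p hp
    calc ∑ q ∈ pts, ‖f p q‖
        ≤ ∑ q ∈ pts, A * (Real.exp (-(δ₁ * ρd p₀ p)) * (ρd p q ^ m * Real.exp (-(δ₁ * ρd p q)))) :=
          Finset.sum_le_sum fun q hq => hpt p hp q hq
      _ = A * Real.exp (-(δ₁ * ρd p₀ p)) * ∑ q ∈ pts, ρd p q ^ m * Real.exp (-(δ₁ * ρd p q)) := by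
          rw [Finset.mul_sum]
          exact Finset.sum_congr rfl fun q _ => by ring
      _ ≤ A * Real.exp (-(δ₁ * ρd p₀ p)) * c1 :=
          mul_le_mul_of_nonneg_left (hsum1 p hp) (mul_nonneg hA0 (Real.exp_pos _).le)
      _ = A * c1 * Real.exp (-(δ₁ * ρd p₀ p)) := by ring
  -- outer sum over p ((S), first clause)
  calc ‖∑ p ∈ pts, ∑ q ∈ pts, f p q‖
      ≤ ∑ p ∈ pts, ∑ q ∈ pts, ‖f p q‖ := (norm_sum_le _ _).trans (Finset.sum_le_sum fun p _ => norm_sum_le _ _)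
    _ ≤ ∑ p ∈ pts, A * c1 * Real.exp (-(δ₁ * ρd p₀ p)) := Finset.sum_le_sum hinner
    _ = A * c1 * ∑ p ∈ pts, Real.exp (-(δ₁ * ρd p₀ p)) := by rw [Finset.mul_sum]
    _ ≤ A * c1 * c0 := mul_le_mul_of_nonneg_left hsum0 (mul_nonneg hA0 hc1)
    _ = Λ * Real.exp Wd * c0 * c1 := by rw [hA]; ring

variable {C : Carriers} {E : Type} {ι α β γ δ Pt : Type} [NormedAddCommGroup E] [NormedSpace ℂ E]

/-- CONSISTENCY (`example`): the owner's `norm_dsum_le` (p214232) is the instance `Λ := cK·M·gain`, `Wd := w·d(X) + w₀` of the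
generic (4.22) arithmetic. [folklore] -/
example {K : KerData C E ι α β γ δ Pt} {ℓ gain : ℕ → ℕ → ℝ} {cK δ₀ δ₁ w w0 c0 c1 d0 : ℝ}
    (hK : K.Admissible ℓ gain cK δ₀ δ₁ w w0 c0 c1 d0) {k : ℕ} {s : ℕ → ℝ} {y : ι} {a : α} (ha : a ∈ K.S0 k y) {b : β}
    (hb : b ∈ K.SY k y a) {j : ℕ} {x : (doubleCarriers C).Dom} (hx : x ∈ K.src k y a j) {t : ℂ}
    (ht : t ∈ sphere (0:ℂ) (K.r k)) {s' : δ → ℝ} {σ' : δ → ℂ} (hsσ : OnContour K.κ₁ (K.cubes k y a b) s' σ')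
    {F : E → ℂ} {M : ℝ} (hF : DifferentiableOn ℂ F (ball 0 (K.R x.1))) (hM : ∀ z ∈ ball (0:E) (K.R x.1), ‖F z‖ ≤ M)
    (hM0 : 0 ≤ M) :
    ‖K.dsum k s y a b x F t s' σ'‖ ≤ cK * Real.exp w0 * c0 * c1 * M * gain k j * Real.exp (w * C.d x.1) := by
  have h := norm_sum_sum_le_of_pointBound (K.pts k y a) (fun p q => K.ker k s y a b x t s' σ' p q F) K.ρd (K.dX x.1)
    (K.p0 x.1) (Wd := w * C.d x.1 + w0) (mul_nonneg (mul_nonneg hK.cK_nonneg hM0) (hK.gain_nonneg k j)) hK.c1_nonneg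
    hK.ρd_nonneg (fun p hp q hq => hK.kerBound k s y a ha b hb j x hx t ht s' σ' hsσ p hp q hq F M hF hM)
    (fun p hp q hq => by have := hK.geom k y a x p hp q hq; linarith) (hK.sum0 k y a x.1) (hK.sum1 k y a)
  calc ‖K.dsum k s y a b x F t s' σ'‖ = ‖∑ p ∈ K.pts k y a, ∑ q ∈ K.pts k y a, K.ker k s y a b x t s' σ' p q F‖ := rfl
    _ ≤ cK * M * gain k j * Real.exp (w * C.d x.1 + w0) * c0 * c1 := h
    _ = cK * Real.exp w0 * c0 * c1 * M * gain k j * Real.exp (w * C.d x.1) := by rw [Real.exp_add]; ring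

omit [NormedAddCommGroup E] [NormedSpace ℂ E] in
/-- The coupling difference of the double point sum is the double sum of the summand differences. [folklore] -/
theorem dsum_sub_dsum (K : KerData C E ι α β γ δ Pt) (k : ℕ) (s s₂ : ℕ → ℝ) (y : ι) (a : α) (b : β)
    (x : (doubleCarriers C).Dom) (F : E → ℂ) (t : ℂ) (s' : δ → ℝ) (σ' : δ → ℂ) :
    K.dsum k s y a b x F t s' σ' - K.dsum k s₂ y a b x F t s' σ' =
      ∑ p ∈ K.pts k y a, ∑ q ∈ K.pts k y a, (K.ker k s y a b x t s' σ' p q F - K.ker k s₂ y a b x t s' σ' p q F) := by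
  simp only [KerData.dsum, ← Finset.sum_sub_distrib]

/-- **THE (4.22) ARITHMETIC FOR THE COUPLING DIFFERENCE**: if, at a contour point and for an analytic `F` bounded by `M` on the
source's ball, the summand's coupling difference obeys the (K)-shape with constant `Λ` — `‖ker_s p q F − ker_{s₂} p q F‖ ≤
Λ·(ρd p q)^m·e^{−δ₀(dX X p + dX X q)}` on the point family (the instance `Λ := cK·λ·M·gain·|s_k − s₂,k|` of binder (K-Lip)) —
then, by (G) and (S) of `KerData.Admissible`, `‖dsum_s F − dsum_{s₂} F‖ ≤ Λ·e^{w₀}·c₀·c₁·e^{w·d(X)}`.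
[cite: Balaban1987RG1, (4.22) p.286] -/
theorem norm_dsum_sub_dsum_le {K : KerData C E ι α β γ δ Pt} {ℓ gain : ℕ → ℕ → ℝ} {cK δ₀ δ₁ w w0 c0 c1 d0 : ℝ}
    (hK : K.Admissible ℓ gain cK δ₀ δ₁ w w0 c0 c1 d0) {k : ℕ} {s s₂ : ℕ → ℝ} {y : ι} {a : α} {b : β}
    {x : (doubleCarriers C).Dom} {t : ℂ} {s' : δ → ℝ} {σ' : δ → ℂ} {F : E → ℂ} {Λ : ℝ} (hΛ : 0 ≤ Λ)
    (hdiff : ∀ p ∈ K.pts k y a, ∀ q ∈ K.pts k y a,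
      ‖K.ker k s y a b x t s' σ' p q F - K.ker k s₂ y a b x t s' σ' p q F‖ ≤
        Λ * K.ρd p q ^ K.m * Real.exp (-(δ₀ * (K.dX x.1 p + K.dX x.1 q)))) :
    ‖K.dsum k s y a b x F t s' σ' - K.dsum k s₂ y a b x F t s' σ'‖ ≤
      Λ * Real.exp w0 * c0 * c1 * Real.exp (w * C.d x.1) := by
  rw [dsum_sub_dsum]
  have h := norm_sum_sum_le_of_pointBound (K.pts k y a)
    (fun p q => K.ker k s y a b x t s' σ' p q F - K.ker k s₂ y a b x t s' σ' p q F) K.ρd (K.dX x.1) (K.p0 x.1)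
    (Wd := w * C.d x.1 + w0) hΛ hK.c1_nonneg hK.ρd_nonneg hdiff
    (fun p hp q hq => by have := hK.geom k y a x p hp q hq; linarith) (hK.sum0 k y a x.1) (hK.sum1 k y a)
  calc ‖∑ p ∈ K.pts k y a, ∑ q ∈ K.pts k y a, (K.ker k s y a b x t s' σ' p q F - K.ker k s₂ y a b x t s' σ' p q F)‖
      ≤ Λ * Real.exp (w * C.d x.1 + w0) * c0 * c1 := h
    _ = Λ * Real.exp w0 * c0 * c1 * Real.exp (w * C.d x.1) := by rw [Real.exp_add]; ring

/-- Under binder (C) (joint continuity of the summand in the contour point for analytic `F`), the double point sum is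
jointly continuous in `(t, s′, σ′)`. [folklore] -/
theorem continuous_dsum (K : KerData C E ι α β γ δ Pt)
    (hkerC : ∀ (k : ℕ) (s : ℕ → ℝ) (y : ι) (a : α) (b : β) (x : (doubleCarriers C).Dom), ∀ p ∈ K.pts k y a,
      ∀ q ∈ K.pts k y a, ∀ F : E → ℂ, DifferentiableOn ℂ F (ball 0 (K.R x.1)) →
        Continuous fun wv : ℂ × (δ → ℝ) × (δ → ℂ) => K.ker k s y a b x wv.1 wv.2.1 wv.2.2 p q F)
    (k : ℕ) (s : ℕ → ℝ) (y : ι) (a : α) (b : β) (x : (doubleCarriers C).Dom) {F : E → ℂ}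
    (hF : DifferentiableOn ℂ F (ball 0 (K.R x.1))) :
    Continuous fun wv : ℂ × (δ → ℝ) × (δ → ℂ) => K.dsum k s y a b x F wv.1 wv.2.1 wv.2.2 := by
  simp only [KerData.dsum]
  exact continuous_finsetSum _ fun p hp => continuous_finsetSum _ fun q hq => hkerC k s y a b x p hp q hq F hF

end DoubleSum

/-! ## §3 The per-piece coupling response of the kernel species on the analytic class -/

section Response

variable {C : Carriers} {E : Type} {ι α β γ δ Pt : Type} [NormedAddCommGroup E] [NormedSpace ℂ E] [DecidableEq δ]

/-- **THE PER-PIECE COUPLING RESPONSE OF THE KERNEL SPECIES, PROVED ON THE ANALYTIC CLASS** — conclusion LITERALLY the `hresp`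
binder of `NE9CPieceCouplingModulus.channelCouplingModulus_cpiece` at `P := K.toC`, rate `κ − w`, `Kp := K.Kp cK w₀ c₀ c₁`,
`qc := λ·N̄`.  DISPLAYED: `hK : K.Admissible …` (owner's (K)/(G)/(S)/…), the window's terms analytic with (1.18)-size `N ≤ N̄`
(`hE`, `hT`, `hNb`), **(C)** `hkerC` (joint continuity of the summand in the contour point), **(K-Lip)** `hkerL` (the
coupling-Lipschitz twin of (K), relative modulus `λ ≥ 0`; [I] (3.2) p. 270: the kernels read g_k through B′ = g_kCB − hD̃(g_kCB);
p. 263 *"C^∞-function of g_{j−1}"*; PROOF-INTERIOR, no printed constant).  Chain: `reIm` difference; §1 `contourFn_sub`;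
`bound_124` with §2's difference bound (M := 2e^{−κd(X)}N_j from `TermSize` on both copies of X); `e^{−κd}e^{wd} = e^{−(κ−w)d}`;
`bound_125` under G1. [cite: Balaban1987RG1, (1.18) p.263, (3.2) p.270, (4.22) p.286; Balaban1988RG2Cluster, (1.21)-(1.25) p.7] -/
theorem cpieceResponse_ker {K : KerData C E ι α β γ δ Pt} {ℓ gain : ℕ → ℕ → ℝ} {cK δ₀ δ₁ w w0 c0 c1 d0 : ℝ}
    (hK : K.Admissible ℓ gain cK δ₀ δ₁ w w0 c0 c1 d0)
    {Ef : Functional (doubleCarriers C) E} {W : Set (ℕ → ℝ)} {κ : ℝ} {N : ℕ → ℝ} {Nbar lam : ℝ}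
    (hE : ∀ g ∈ W, Ef g ∈ analyticClass K.R) (hT : TermSize Ef W κ N) (hN0 : ∀ j, 0 ≤ N j) (hNb : ∀ j, N j ≤ Nbar)
    (hlam : 0 ≤ lam)
    (hkerC : ∀ (k : ℕ) (s : ℕ → ℝ) (y : ι) (a : α) (b : β) (x : (doubleCarriers C).Dom), ∀ p ∈ K.pts k y a,
      ∀ q ∈ K.pts k y a, ∀ F : E → ℂ, DifferentiableOn ℂ F (ball 0 (K.R x.1)) →
        Continuous fun wv : ℂ × (δ → ℝ) × (δ → ℂ) => K.ker k s y a b x wv.1 wv.2.1 wv.2.2 p q F)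
    (hkerL : ∀ g ∈ W, ∀ g' ∈ W, ∀ (k : ℕ) (y : ι), ∀ a ∈ K.S0 k y, ∀ b ∈ K.SY k y a, ∀ (j : ℕ), ∀ x ∈ K.src k y a j,
      ∀ t ∈ sphere (0:ℂ) (K.r k), ∀ (s' : δ → ℝ) (σ' : δ → ℂ), OnContour K.κ₁ (K.cubes k y a b) s' σ' →
        ∀ p ∈ K.pts k y a, ∀ q ∈ K.pts k y a, ∀ (F : E → ℂ) (M : ℝ),
          DifferentiableOn ℂ F (ball 0 (K.R x.1)) → (∀ z ∈ ball (0:E) (K.R x.1), ‖F z‖ ≤ M) →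
            ‖K.ker k g y a b x t s' σ' p q F - K.ker k g' y a b x t s' σ' p q F‖ ≤
              cK * lam * M * gain k j * K.ρd p q ^ K.m * Real.exp (-(δ₀ * (K.dX x.1 p + K.dX x.1 q))) * |g k - g' k|) :
    ∀ g ∈ W, ∀ g' ∈ W, ∀ (k : ℕ) (y : ι), ∀ a ∈ K.toC.S0 k y, ∀ b ∈ K.toC.SY k y a, ∀ (j : ℕ), ∀ x ∈ K.toC.src k y a j,
      |K.toC.piece k g y a b x (Ef g) - K.toC.piece k g' y a b x (Ef g)| ≤
        K.Kp cK w0 c0 c1 k y * (lam * Nbar) * gain k j * Real.exp (-((κ - w) * (doubleCarriers C).d x)) *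
          Real.exp (-(1 / 8) * (K.κ₁ - 1) * K.toC.dY k y + (1 / 8) * K.κ₁ * d0 - (1 / 2) * (K.κ₁ - 1) * K.toC.vol k y a b) *
            |g k - g' k| := by
  intro g hg g' hg' k y a ha b hb j x hx
  -- letters
  set X : C.Dom := x.1 with hXdef
  set l := K.cubes k y a b with hl
  set M : ℝ := 2 * (Real.exp (-(κ * C.d X)) * N j) with hM
  have hj : C.scale X = j := hK.srcScale k y a j x hx
  have hFan : DifferentiableOn ℂ (lift (Ef g) X) (ball 0 (K.R X)) := hE g hg X
  -- the size of the complex old term on the ball, from (1.18) on both copies of X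
  have hMbd : ∀ z ∈ ball (0 : E) (K.R X), ‖lift (Ef g) X z‖ ≤ M := by
    intro z _
    have h1 := hT g hg z (X, true)
    have h2 := hT g hg z (X, false)
    have hsc : (doubleCarriers C).scale (X, true) = j := hj
    have hsc' : (doubleCarriers C).scale (X, false) = j := hj
    rw [hsc] at h1; rw [hsc'] at h2
    exact norm_lift_le h1 h2
  have hM0 : 0 ≤ M := by rw [hM]; exact mul_nonneg zero_le_two (mul_nonneg (Real.exp_pos _).le (hN0 j))
  have hg0 : 0 ≤ gain k j := hK.gain_nonneg k j
  -- the integrand bound on the contours: the (4.22) arithmetic for the coupling difference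
  set S : ℝ := cK * lam * M * gain k j * |g k - g' k| * Real.exp w0 * c0 * c1 * Real.exp (w * C.d X) with hS
  have hS0 : 0 ≤ S := by
    rw [hS]
    have := hK.cK_nonneg; have := hK.c0_nonneg; have := hK.c1_nonneg
    positivity
  have hS' : ∀ t ∈ Metric.sphere (0:ℂ) (K.r k), ∀ s' σ',
      (∀ i ∈ l, s' i ∈ Set.Icc (0:ℝ) 1 ∧ σ' i ∈ Metric.sphere (0:ℂ) (Real.exp K.κ₁)) →
        ‖K.dsum k g y a b x (lift (Ef g) X) t s' σ' - K.dsum k g' y a b x (lift (Ef g) X) t s' σ'‖ ≤ S := by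
    intro t ht s' σ' hsσ
    have hΛ : 0 ≤ cK * lam * M * gain k j * |g k - g' k| :=
      mul_nonneg (mul_nonneg (mul_nonneg (mul_nonneg hK.cK_nonneg hlam) hM0) hg0) (abs_nonneg _)
    have h := norm_dsum_sub_dsum_le hK (s := g) (s₂ := g') (b := b) (t := t) (s' := s') (σ' := σ') (F := lift (Ef g) X) hΛ
      (fun p hp q hq => by
        have h1 := hkerL g hg g' hg' k y a ha b hb j x hx t ht s' σ' hsσ p hp q hq (lift (Ef g) X) M hFan hMbd
        calc ‖K.ker k g y a b x t s' σ' p q (lift (Ef g) X) - K.ker k g' y a b x t s' σ' p q (lift (Ef g) X)‖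
            ≤ cK * lam * M * gain k j * K.ρd p q ^ K.m * Real.exp (-(δ₀ * (K.dX x.1 p + K.dX x.1 q))) * |g k - g' k| := h1
          _ = cK * lam * M * gain k j * |g k - g' k| * K.ρd p q ^ K.m *
                Real.exp (-(δ₀ * (K.dX x.1 p + K.dX x.1 q))) := by ring)
    calc ‖K.dsum k g y a b x (lift (Ef g) X) t s' σ' - K.dsum k g' y a b x (lift (Ef g) X) t s' σ'‖
        ≤ cK * lam * M * gain k j * |g k - g' k| * Real.exp w0 * c0 * c1 * Real.exp (w * C.d x.1) := h
      _ = S := by rw [hS]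
  -- (1.24) on the difference integrand and (1.25)
  have h124 := B13Sect1Arith.bound_124 hK.κ₁_ge (hK.r_pos k) hS0 l
    (fun t s' σ' => K.dsum k g y a b x (lift (Ef g) X) t s' σ' - K.dsum k g' y a b x (lift (Ef g) X) t s' σ') hS' _ _
    (onContour_base K.κ₁ l)
  have h125 := B13Sect1Arith.bound_125 (N := (l.length : ℝ)) (dY := K.dY k y) hK.κ₁_ge hK.d0_nonneg (hK.G1 k y a ha b hb)
  have hr0 : 0 < K.r k := hK.r_pos k
  -- binder (C) ⇒ the two integrand families are jointly continuous ⇒ the contour functional is subtractive (§1)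
  have hρ1 : 1 < Real.exp K.κ₁ := by have := Real.add_one_le_exp K.κ₁; linarith [hK.κ₁_ge]
  have hC : ∀ s : ℕ → ℝ,
      Continuous fun wv : ℂ × (δ → ℝ) × (δ → ℂ) => K.dsum k s y a b x (lift (Ef g) X) wv.1 wv.2.1 wv.2.2 :=
    fun s => continuous_dsum K hkerC k s y a b x hFan
  have hsub := contourFn_sub hρ1 hr0 l (G₁ := fun t s' σ' => K.dsum k g y a b x (lift (Ef g) X) t s' σ')
    (G₂ := fun t s' σ' => K.dsum k g' y a b x (lift (Ef g) X) t s' σ') (hC g) (hC g') (fun _ => (0:ℝ))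
    (fun _ => ((Real.exp K.κ₁ : ℝ) : ℂ))
  -- assemble
  show |reIm x.2 ((2 * Real.pi * I : ℂ)⁻¹ • ∮ t in C(0, K.r k), (t ^ 2)⁻¹ •
      cauchyOp (Real.exp K.κ₁) (K.cubes k y a b) (fun s' σ' => K.dsum k g y a b x (lift (Ef g) x.1) t s' σ')
        (fun _ => (0:ℝ)) (fun _ => ((Real.exp K.κ₁ : ℝ) : ℂ))) -
      reIm x.2 ((2 * Real.pi * I : ℂ)⁻¹ • ∮ t in C(0, K.r k), (t ^ 2)⁻¹ •
      cauchyOp (Real.exp K.κ₁) (K.cubes k y a b) (fun s' σ' => K.dsum k g' y a b x (lift (Ef g) x.1) t s' σ')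
        (fun _ => (0:ℝ)) (fun _ => ((Real.exp K.κ₁ : ℝ) : ℂ)))| ≤
      K.Kp cK w0 c0 c1 k y * (lam * Nbar) * gain k j * Real.exp (-((κ - w) * (doubleCarriers C).d x)) *
        Real.exp (-(1 / 8) * (K.κ₁ - 1) * K.toC.dY k y + (1 / 8) * K.κ₁ * d0 - (1 / 2) * (K.κ₁ - 1) * K.toC.vol k y a b) *
          |g k - g' k|
  have hdx : (doubleCarriers C).d x = C.d X := rfl
  have hdY : K.toC.dY k y = K.dY k y := rfl
  have hvol : K.toC.vol k y a b = (l.length : ℝ) := rfl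
  have hexp : Real.exp (-(κ * C.d X)) * Real.exp (w * C.d X) = Real.exp (-((κ - w) * C.d X)) := by
    rw [← Real.exp_add]; congr 1; ring
  rw [hdx, hdY, hvol, ← hXdef, ← hl, ← reIm_sub, ← hsub]
  have hNj : M ≤ 2 * (Real.exp (-(κ * C.d X)) * Nbar) := by
    rw [hM]; exact mul_le_mul_of_nonneg_left (mul_le_mul_of_nonneg_left (hNb j) (Real.exp_pos _).le) zero_le_two
  have hSle : S ≤ cK * lam * (2 * (Real.exp (-(κ * C.d X)) * Nbar)) * gain k j * |g k - g' k| * Real.exp w0 * c0 * c1 *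
      Real.exp (w * C.d X) := by
    rw [hS]
    have := hK.cK_nonneg; have := hK.c0_nonneg; have := hK.c1_nonneg
    gcongr
  calc |reIm x.2 ((2 * Real.pi * I : ℂ)⁻¹ • ∮ t in C(0, K.r k), (t ^ 2)⁻¹ •
          cauchyOp (Real.exp K.κ₁) l (fun s' σ' => K.dsum k g y a b x (lift (Ef g) X) t s' σ' -
            K.dsum k g' y a b x (lift (Ef g) X) t s' σ') (fun _ => (0:ℝ)) (fun _ => ((Real.exp K.κ₁ : ℝ) : ℂ)))|
        ≤ ‖(2 * Real.pi * I : ℂ)⁻¹ • ∮ t in C(0, K.r k), (t ^ 2)⁻¹ •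
          cauchyOp (Real.exp K.κ₁) l (fun s' σ' => K.dsum k g y a b x (lift (Ef g) X) t s' σ' -
            K.dsum k g' y a b x (lift (Ef g) X) t s' σ') (fun _ => (0:ℝ)) (fun _ => ((Real.exp K.κ₁ : ℝ) : ℂ))‖ :=
        abs_reIm_le _ _
    _ ≤ 1 / K.r k * S * Real.exp (-(K.κ₁ - 1) * l.length) := h124
    _ ≤ 1 / K.r k * (cK * lam * (2 * (Real.exp (-(κ * C.d X)) * Nbar)) * gain k j * |g k - g' k| * Real.exp w0 * c0 * c1 *
          Real.exp (w * C.d X)) *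
          Real.exp (-(1 / 8) * (K.κ₁ - 1) * K.dY k y + (1 / 8) * K.κ₁ * d0 - (1 / 2) * (K.κ₁ - 1) * l.length) := by
        refine mul_le_mul (mul_le_mul_of_nonneg_left hSle (div_pos one_pos hr0).le) h125 (Real.exp_pos _).le ?_
        exact mul_nonneg (div_pos one_pos hr0).le (hS0.trans hSle)
    _ = K.Kp cK w0 c0 c1 k y * (lam * Nbar) * gain k j * (Real.exp (-(κ * C.d X)) * Real.exp (w * C.d X)) *
          Real.exp (-(1 / 8) * (K.κ₁ - 1) * K.dY k y + (1 / 8) * K.κ₁ * d0 - (1 / 2) * (K.κ₁ - 1) * l.length) *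
            |g k - g' k| := by
        simp only [KerData.Kp]; ring
    _ = K.Kp cK w0 c0 c1 k y * (lam * Nbar) * gain k j * Real.exp (-((κ - w) * C.d X)) *
          Real.exp (-(1 / 8) * (K.κ₁ - 1) * K.dY k y + (1 / 8) * K.κ₁ * d0 - (1 / 2) * (K.κ₁ - 1) * l.length) *
            |g k - g' k| := by rw [hexp]

/-! ## §4 Leaf A3 (`hTcup`) for the kernel species' channel -/

/-- **LEAF A3 FOR THE KERNEL SPECIES ON THE ANALYTIC CLASS**: the END's `hTcup` for `T := cpieceChannel K.toC` at the window
family `Ef`, with the S5 weight `weightOf K.toC.frame κ₁ d₀ O1 (K.Kp cK w₀ c₀ c₁)` (the SAME as `channelSizeAtStepNN_ker`'s, so S5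
and A3 of species (b) meet (w25)-M's `hwb` with one weight) and the k-UNIFORM **`qT := λ·N̄·c_Q·(1 − ω)⁻¹`** — p212551's
`channelCouplingModulus_cpiece` APPLIED BY NAME at the OUTPUT rate `κ − w` with `LevelCountsG K.toC.frame (κ − w) …` ([II] p. 8;
ω = L^{−β} for the (4.30)-species, O-ne9p1g23-1).  NOT PRINTED, not claimed: that Bałaban's (4.21)/(4.25)/(4.29)/(4.30) kernels
meet these binders (O-NE9-1). [cite: Balaban1988RG2Cluster, (1.21)-(1.29) pp.7-8, (1.36) p.9; Balaban1987RG1, (4.22) p.286, p.288] -/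
theorem channelCouplingModulus_ker {K : KerData C E ι α β γ δ Pt} {ℓ gain : ℕ → ℕ → ℝ} {cK δ₀ δ₁ w w0 c0 c1 d0 : ℝ}
    (hK : K.Admissible ℓ gain cK δ₀ δ₁ w w0 c0 c1 d0)
    {Ef : Functional (doubleCarriers C) E} {W : Set (ℕ → ℝ)} {κ : ℝ} {N : ℕ → ℝ} {Nbar lam O1 cQ ω : ℝ}
    (hE : ∀ g ∈ W, Ef g ∈ analyticClass K.R) (hT : TermSize Ef W κ N) (hN0 : ∀ j, 0 ≤ N j) (hNb : ∀ j, N j ≤ Nbar)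
    (hlam : 0 ≤ lam)
    (hkerC : ∀ (k : ℕ) (s : ℕ → ℝ) (y : ι) (a : α) (b : β) (x : (doubleCarriers C).Dom), ∀ p ∈ K.pts k y a,
      ∀ q ∈ K.pts k y a, ∀ F : E → ℂ, DifferentiableOn ℂ F (ball 0 (K.R x.1)) →
        Continuous fun wv : ℂ × (δ → ℝ) × (δ → ℂ) => K.ker k s y a b x wv.1 wv.2.1 wv.2.2 p q F)
    (hkerL : ∀ g ∈ W, ∀ g' ∈ W, ∀ (k : ℕ) (y : ι), ∀ a ∈ K.S0 k y, ∀ b ∈ K.SY k y a, ∀ (j : ℕ), ∀ x ∈ K.src k y a j,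
      ∀ t ∈ sphere (0:ℂ) (K.r k), ∀ (s' : δ → ℝ) (σ' : δ → ℂ), OnContour K.κ₁ (K.cubes k y a b) s' σ' →
        ∀ p ∈ K.pts k y a, ∀ q ∈ K.pts k y a, ∀ (F : E → ℂ) (M : ℝ),
          DifferentiableOn ℂ F (ball 0 (K.R x.1)) → (∀ z ∈ ball (0:E) (K.R x.1), ‖F z‖ ≤ M) →
            ‖K.ker k g y a b x t s' σ' p q F - K.ker k g' y a b x t s' σ' p q F‖ ≤
              cK * lam * M * gain k j * K.ρd p q ^ K.m * Real.exp (-(δ₀ * (K.dX x.1 p + K.dX x.1 q))) * |g k - g' k|)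
    (hL : LevelCountsG K.toC.frame (κ - w) K.κ₁ O1 cQ gain (agePow ω)) (hO1 : 0 ≤ O1) (hcQ : 0 ≤ cQ) (hω0 : 0 ≤ ω)
    (hω1 : ω < 1) :
    ∀ g ∈ W, ∀ g' ∈ W, ∀ (k : ℕ) (y : ι),
      |cpieceChannel K.toC k g (Ef g) y - cpieceChannel K.toC k g' (Ef g) y| ≤
        weightOf K.toC.frame K.κ₁ d0 O1 (K.Kp cK w0 c0 c1) k y * (lam * Nbar * cQ * (1 - ω)⁻¹ * |g k - g' k|) :=
  channelCouplingModulus_cpiece K.toC (H := Ef) (κ := κ - w) (cpieceResponse_ker hK hE hT hN0 hNb hlam hkerC hkerL) hL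
    (kp_nonneg_ker hK) (mul_nonneg hlam ((hN0 0).trans (hNb 0))) hO1 hK.gain_nonneg hcQ hω0 hω1

end Response

end Summit.QuantumFields.BalabanUV.T4Continuum.NE9KernelSpeciesCoupling

end
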